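import Summits.KontsevichZagierPeriods.KontsevichZagierPeriods.Theorems.RootDecompPureDefectProperCone
import Summits.KontsevichZagierPeriods.KontsevichZagierPeriods.Theses.RootDecompOrderCut

/-!
# Route RootDecompOrderCut (O) — edges proved BY NAME against the born texts (rev 0, commit 126406117d34)

Landing file #2 of the decomp-kz lens-5 seat (generation 10); PART 2 of a two-part chain — it imports part 1
(`Theorems.RootDecompPureDefectProperCone`, the positivity calculus + `posCertificate` + the edge `ProperCone ⟹
PiConnected` over route E″) and route O's file.  Proposal shape (after part 1 is ACCEPTED and O's module is built):
`ledger propose --kind proof --target Summits/KontsevichZagierPeriods/KontsevichZagierPeriods/Theorems/RootDecompOrderCutEdges.lean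
 --supports stmt-KontsevichZagierPeriods-32161`.

Contents (all sorry-free, standard axioms; every statement over the born decls `DefectNegligible` (32161),
`ProperCone` (31891), `ReducedPeriodRing` (3929) of `Theses/RootDecompOrderCut.lean` and `PiFlatDefect` (27508),
`PiConnected` (27509) of `Theses/RootDecompPureDefect.lean`):
* §1 by-name identifications: O's `ProperCone` IS E″'s (`Iff.rfl`, one shared item 31891); O's `DefectNegligible`
  unfolds to the cone form; `ReducedPeriodRing` read on `P`;
* §2 the converses `S ⟹ DefectNegligible / ProperCone / ReducedPeriodRing` and EXACTNESS of route O by name: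
  `summit_iff_orderCut : KontsevichZagierPeriods ↔ DefectNegligible ∧ ProperCone ∧ ReducedPeriodRing`
  (uses the route's own deciding theorem `RootDecompOrderCut.closes`);
* §3 THE CROSS-ROUTE EDGE `defectNegligible_of_piFlatDefect : PiFlatDefect → DefectNegligible` (item 27508 of E″
  feeds item 32161 of O; content = `posCertificate`), and `defectNegligible_of_kernelNil` (the nil branch feeds DN);
* §4 THE ORDER-EMBEDDING PACKAGE (lens-5 g10 node `S ⟺ DN ∧ Orderable`, written with explicit binders — no `Prop`
  definition in a Theorems file): an injective ring map `φ : P → K` into a linearly ordered ring, non-negative on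
  classes of positive value, gives `ProperCone`, `ReducedPeriodRing`, «`P` is a domain», and with `DefectNegligible`
  the summit (`summit_of_defectNegligible_of_orderEmbedding`, five lines, no `posCertificate`); conversely the summit
  gives such a `φ` (`K = ℝ`, `φ = evalP`): `summit_iff_defectNegligible_orderEmbedding`;
* §5 consequences of `ProperCone ∧ ReducedPeriodRing` short of the summit: `cancellation_of_order` (classes of
  non-zero value are non-zero-divisors), `quadRigid_of_order` (square roots of a common non-zero value coincide) and
  the Γ-facing `indexTwo_torsion_of_properCone` (on an index-two pair, `ProperCone` ALONE gives the pair identity up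
  to `ϖ`-torsion) — the lens verdict that instances of 31891 at believed-zero elements are summit instances.

Source: HOME/decomp-kz-lens-5/g10/PureDefect.lean §§12–13 (farm rc 0, 0 sorry).
-/

noncomputable section

namespace Summit.KontsevichZagierPeriods.RootDecompOrderCut

open Literature.NumberTheory.Transcendental Literature.NumberTheory.Transcendental.KZ
open Summit.KontsevichZagierPeriods.KontsevichZagierPeriods.Theses
open Summit.KontsevichZagierPeriods.KontsevichZagierPeriods.Theses.RootDecompOrderCut
open Summit.KontsevichZagierPeriods.RootDecompPureDefect

/-! ## 1. By-name identifications -/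

/-- Route O's `ProperCone` and route E″'s `ProperCone` are the same statement (one shared item 31891). -/
theorem properCone_iff_pureDefect :
    RootDecompOrderCut.ProperCone ↔ RootDecompPureDefect.ProperCone := Iff.rfl

/-- `ProperCone ↔ T ∩ −T = 0` for the cone `posCone` of part 1. -/
theorem properCone_iff_posCone :
    RootDecompOrderCut.ProperCone ↔ ∀ t : FormalPeriodRing, t ∈ posCone → -t ∈ posCone → t = 0 := Iff.rfl

/-- `DefectNegligible` in cone form. -/
theorem defectNegligible_iff_posCone :
    DefectNegligible ↔ ∀ x : FormalPeriodRing, evalP x = 0 →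
      ∃ (m : ℕ) (t : FormalPeriodRing), t ∈ posCone ∧ x ^ (2 * (m + 1)) + t = 0 := Iff.rfl

/-- `ReducedPeriodRing` (item 3929, stated on `FormalRep`) read on the quotient `P`. -/
theorem reducedPeriodRing_iff :
    ReducedPeriodRing ↔ ∀ x : FormalPeriodRing, x * x = 0 → x = 0 := by
  constructor
  · intro h x hx
    obtain ⟨c, rfl⟩ := toFormalPeriod_surjective x
    rw [← map_mul, toFormalPeriod_eq_zero_iff] at hx
    exact toFormalPeriod_eq_zero_iff.mpr (h c hx)
  · intro h c hc
    have h1 : toFormalPeriod c * toFormalPeriod c = 0 := by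
      rw [← map_mul]; exact toFormalPeriod_eq_zero_iff.mpr hc
    exact toFormalPeriod_eq_zero_iff.mp (h _ h1)

/-! ## 2. Converses and exactness of route O -/

/-- Auxiliary step `properCone_of_summit`. [bookkeeping] -/
theorem properCone_of_summit (h : _root_.KontsevichZagierPeriods) : RootDecompOrderCut.ProperCone :=
  RootDecompPureDefect.properCone_of_summit h

/-- Auxiliary step `defectNegligible_of_summit`. [bookkeeping] -/
theorem defectNegligible_of_summit (h : _root_.KontsevichZagierPeriods) : DefectNegligible := by
  rw [summit_iff_kernel] at h
  intro x hx
  exact ⟨0, 0, posCone.zero_mem, by rw [h x hx]; simp⟩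

/-- Auxiliary step `reducedPeriodRing_of_summit`. [bookkeeping] -/
theorem reducedPeriodRing_of_summit (h : _root_.KontsevichZagierPeriods) : ReducedPeriodRing := by
  rw [reducedPeriodRing_iff]
  rw [summit_iff_kernel] at h
  intro x hx
  apply h
  have h1 := congrArg evalP hx
  rw [map_mul, map_zero] at h1
  exact mul_self_eq_zero.mp h1

/-- **EXACTNESS of route O by name**: `S ⟺ DefectNegligible ∧ ProperCone ∧ ReducedPeriodRing`
(`⟸` is the route's deciding theorem `closes`). -/
theorem summit_iff_orderCut :
    _root_.KontsevichZagierPeriods ↔ DefectNegligible ∧ RootDecompOrderCut.ProperCone ∧ ReducedPeriodRing :=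
  ⟨fun h => ⟨defectNegligible_of_summit h, properCone_of_summit h, reducedPeriodRing_of_summit h⟩,
    fun h => RootDecompOrderCut.closes h.1 h.2.1 h.2.2⟩

/-! ## 3. What feeds `DefectNegligible` -/

/-- **EDGE: the nil branch feeds DN** — if every defect is nilpotent then `DefectNegligible` (slack `t = 0`). -/
theorem defectNegligible_of_kernelNil
    (hN : ∀ x : FormalPeriodRing, evalP x = 0 → IsNilpotent x) : DefectNegligible := by
  intro x hx
  obtain ⟨n, hn⟩ := hN x hx
  refine ⟨n, 0, posCone.zero_mem, ?_⟩
  rw [add_zero]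
  exact pow_eq_zero_of_le (by omega) hn

/-- **CROSS-ROUTE EDGE: item 27508 (`PiFlatDefect`, route E″) feeds item 32161 (`DefectNegligible`, route O).**
From `ϖᵏx = x²h` put `g := ϖᵏ(ϖᵏ − 2xh)`: `v g = π²ᵏ > 0` and `g·x² = −(ϖᵏx)²`; with `(M+1)g = 1 + c`
(`posCertificate`, part 1): `x² + (c·x² + (M+1)·(ϖᵏx)²) = 0`, and the bracket lies in `T`. -/
theorem defectNegligible_of_piFlatDefect (hU : RootDecompPureDefect.PiFlatDefect) : DefectNegligible := by
  intro x hx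
  obtain ⟨k, h, hk⟩ := hU x hx
  change piClass ^ k * x = x * x * h at hk
  set y : FormalPeriodRing := piClass ^ k * x with hy
  set g : FormalPeriodRing := piClass ^ k * (piClass ^ k - 2 * (x * h)) with hg
  have e1 : g * (x * x) = -(y * y) := by
    rw [hg, hy]
    have : piClass ^ k * (piClass ^ k - 2 * (x * h)) * (x * x) + piClass ^ k * x * (piClass ^ k * x) = 0 := by
      linear_combination (2 * piClass ^ k * x) * hk
    exact eq_neg_of_add_eq_zero_left this
  have hvg : 0 < evalP g := by
    rw [hg, map_mul, map_sub, map_mul, map_mul, hx, zero_mul, mul_zero, sub_zero, ← map_mul, ← pow_add,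
      evalP_piClass_pow]
    positivity
  obtain ⟨M, c, hc, hM⟩ := posCertificate g hvg
  refine ⟨0, c * (x * x) + ((M : FormalPeriodRing) + 1) * (y * y), posCone.add_mem (mul_sq_mem_posCone hc x) ?_,
    ?_⟩
  · have : ((M : FormalPeriodRing) + 1) * (y * y) = (M + 1) • (y * y) := by rw [nsmul_eq_mul]; push_cast; ring
    rw [this]; exact posCone.nsmul_mem (sq_mem_posCone y) _
  · rw [show 2 * (0 + 1) = 2 by rfl, sq]
    linear_combination (-(x * x)) * hM + ((M : FormalPeriodRing) + 1) * e1

/-! ## 4. The order-embedding package (`S ⟺ DefectNegligible ∧ Orderable`, binders explicit) -/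

section OrderEmbedding

variable {K : Type*} [CommRing K] [LinearOrder K] [IsStrictOrderedRing K]

/-- Under a ring map non-negative on classes of positive value, every element of the cone `T` is non-negative. -/
theorem nonneg_of_mem_posCone (φ : FormalPeriodRing →+* K) (hφ : ∀ c : FormalPeriodRing, 0 < evalP c → 0 ≤ φ c)
    {t : FormalPeriodRing} (ht : t ∈ posCone) : 0 ≤ φ t := by
  refine posCone_induction (motive := fun t => 0 ≤ φ t) (fun c p hc => ?_) ?_ (fun x y hx hy => ?_) ht
  · rw [map_mul, map_mul]
    exact mul_nonneg (hφ c hc) (mul_self_nonneg _)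
  · rw [map_zero]
  · rw [map_add]; exact add_nonneg hx hy

/-- An order-embedding gives `ProperCone` (item 31891). -/
theorem properCone_of_orderEmbedding (φ : FormalPeriodRing →+* K) (hinj : Function.Injective φ)
    (hφ : ∀ c : FormalPeriodRing, 0 < evalP c → 0 ≤ φ c) : RootDecompOrderCut.ProperCone := by
  intro t ht hnt
  have h1 := nonneg_of_mem_posCone φ hφ ht
  have h2 := nonneg_of_mem_posCone φ hφ hnt
  rw [map_neg] at h2
  exact hinj (by rw [map_zero]; linarith)

/-- An injective ring map into a linearly ordered ring makes `P` a domain. -/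
theorem domain_of_embedding (φ : FormalPeriodRing →+* K) (hinj : Function.Injective φ) :
    ∀ x y : FormalPeriodRing, x * y = 0 → x = 0 ∨ y = 0 := by
  intro x y hxy
  have h := congrArg φ hxy
  rw [map_mul, map_zero] at h
  rcases mul_eq_zero.mp h with h1 | h1
  · exact Or.inl (hinj (by rw [h1, map_zero]))
  · exact Or.inr (hinj (by rw [h1, map_zero]))

/-- An injective ring map into a linearly ordered ring gives `ReducedPeriodRing` (item 3929). -/
theorem reducedPeriodRing_of_embedding (φ : FormalPeriodRing →+* K) (hinj : Function.Injective φ) :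
    ReducedPeriodRing :=
  reducedPeriodRing_iff.mpr fun x hx => (domain_of_embedding φ hinj x x hx).elim id id

/-- **`DefectNegligible` + an order-embedding ⟹ the summit**, in five lines and without `posCertificate`:
for a defect `x`, `φ(x)^{2(m+1)} ≥ 0` and `φ(t) ≥ 0` sum to `0`. -/
theorem summit_of_defectNegligible_of_orderEmbedding (hN : DefectNegligible) (φ : FormalPeriodRing →+* K)
    (hinj : Function.Injective φ) (hφ : ∀ c : FormalPeriodRing, 0 < evalP c → 0 ≤ φ c) :
    _root_.KontsevichZagierPeriods := by
  rw [summit_iff_kernel]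
  intro x hx
  obtain ⟨m, t, ht, hmt⟩ := hN x hx
  have h1 : 0 ≤ φ t := nonneg_of_mem_posCone φ hφ ht
  have h2 : 0 ≤ φ (x ^ (2 * (m + 1))) := by
    rw [map_pow, pow_mul]; exact pow_nonneg (sq_nonneg _) _
  have h3 : φ (x ^ (2 * (m + 1))) + φ t = 0 := by rw [← map_add, hmt, map_zero]
  have h4 : φ x ^ (2 * (m + 1)) = 0 := by
    rw [← map_pow]; exact le_antisymm (by linarith) h2
  have h5 : φ x = 0 := pow_eq_zero_iff (by omega) |>.mp h4
  exact hinj (by rw [h5, map_zero])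

end OrderEmbedding

/-- **EXACT (lens-5 g10 node, binders explicit): `S ⟺ DefectNegligible ∧ (∃ order-embedding of P)`.**
`⟹`: `K = ℝ`, `φ = evalP`. -/
theorem summit_iff_defectNegligible_orderEmbedding :
    _root_.KontsevichZagierPeriods ↔ DefectNegligible ∧
      ∃ (K : Type) (_ : CommRing K) (_ : LinearOrder K) (_ : IsStrictOrderedRing K) (φ : FormalPeriodRing →+* K),
        Function.Injective φ ∧ ∀ c : FormalPeriodRing, 0 < evalP c → 0 ≤ φ c := by
  constructor
  · intro h
    refine ⟨defectNegligible_of_summit h, ℝ, inferInstance, inferInstance, inferInstance, evalP, ?_, fun _ hc => hc.le⟩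
    rw [summit_iff_kernel] at h
    intro x y hxy
    rw [← sub_eq_zero] at hxy ⊢
    exact h _ (by rw [map_sub]; exact hxy)
  · rintro ⟨hN, K, _, _, _, φ, hinj, hφ⟩
    exact summit_of_defectNegligible_of_orderEmbedding hN φ hinj hφ

/-- The order-embedding alone already gives the two reality pieces of route O and integrity of `P`. -/
theorem orderCut_reality_of_orderEmbedding {K : Type*} [CommRing K] [LinearOrder K] [IsStrictOrderedRing K]
    (φ : FormalPeriodRing →+* K) (hinj : Function.Injective φ)
    (hφ : ∀ c : FormalPeriodRing, 0 < evalP c → 0 ≤ φ c) :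
    RootDecompOrderCut.ProperCone ∧ ReducedPeriodRing ∧ ∀ x y : FormalPeriodRing, x * y = 0 → x = 0 ∨ y = 0 :=
  ⟨properCone_of_orderEmbedding φ hinj hφ, reducedPeriodRing_of_embedding φ hinj, domain_of_embedding φ hinj⟩

/-! ## 5. Consequences of `ProperCone ∧ ReducedPeriodRing` short of the summit -/

/-- `ProperCone ∧ ReducedPeriodRing ⟹` classes of non-zero value are non-zero-divisors. -/
theorem cancellation_of_order (hP : RootDecompOrderCut.ProperCone) (hR : ReducedPeriodRing) :
    ∀ g x : FormalPeriodRing, evalP g ≠ 0 → g * x = 0 → x = 0 := by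
  rw [reducedPeriodRing_iff] at hR
  intro g x hg hgx
  apply hR
  exact sqCancel_of_properCone hP g x hg (by rw [← mul_assoc, hgx, zero_mul])

/-- `ProperCone ∧ ReducedPeriodRing ⟹ PiConnected` (item 27509) — also directly from `ProperCone` alone
(part 1, `piConnected_of_properCone`). -/
theorem piConnected_of_order (hP : RootDecompOrderCut.ProperCone) (_hR : ReducedPeriodRing) :
    RootDecompPureDefect.PiConnected :=
  piConnected_of_properCone hP

/-- **Quadratic rigidity**: under `ProperCone ∧ ReducedPeriodRing`, two square roots of a common square with the
same non-zero value coincide (`(u + w)(u − w) = 0`, `v(u + w) = 2·v w ≠ 0`). -/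
theorem quadRigid_of_order (hP : RootDecompOrderCut.ProperCone) (hR : ReducedPeriodRing) :
    ∀ u w : FormalPeriodRing, u * u = w * w → evalP u = evalP w → evalP w ≠ 0 → u = w := by
  intro u w huw hv hw
  have h0 : (u + w) * (u - w) = 0 := by linear_combination huw
  have hne : evalP (u + w) ≠ 0 := by rw [map_add, hv, ← two_mul]; exact mul_ne_zero two_ne_zero hw
  exact sub_eq_zero.mp (cancellation_of_order hP hR _ _ hne h0)

/-- The summit gives quadratic rigidity outright. -/
theorem quadRigid_of_summit (h : _root_.KontsevichZagierPeriods) :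
    ∀ u w : FormalPeriodRing, u * u = w * w → evalP u = evalP w → evalP w ≠ 0 → u = w := by
  rw [summit_iff_kernel] at h
  intro u w _ hv _
  rw [← sub_eq_zero]
  exact h _ (by rw [map_sub, hv, sub_self])

/-- **On the index-two stratum `ProperCone` ALONE gives the pair identity up to `ϖ`-torsion**: for any `g` with
`ϖʲ·(g² − ϖ²ⁱ) = 0` and `v g = πⁱ`, `ϖ^{i+j}·(ϖ^{i+j} − ϖʲ·g) = 0`.  (Lens verdict: an instance of item 31891 at
such a believed-zero element is a summit instance up to torsion — no rung outside the summit's known regime.) -/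
theorem indexTwo_torsion_of_properCone (hP : RootDecompOrderCut.ProperCone) (g : FormalPeriodRing) (i j : ℕ)
    (hrel : piClass ^ j * (g * g - piClass ^ (2 * i)) = 0) (hv : evalP g = Real.pi ^ i) :
    piClass ^ (i + j) * (piClass ^ (i + j) - piClass ^ j * g) = 0 := by
  have huw : (piClass ^ j * g) * (piClass ^ j * g) = piClass ^ (i + j) * piClass ^ (i + j) := by
    linear_combination (piClass ^ j) * hrel
  have hvw : evalP (piClass ^ j * g) = evalP (piClass ^ (i + j)) := by
    rw [map_mul, evalP_piClass_pow, evalP_piClass_pow, hv]; ring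
  exact sqRoot_torsion_of_properCone hP _ _ huw hvw (evalP_piClass_pow_pos _)

/-- With `ReducedPeriodRing` as well the torsion disappears: `ϖʲ·g = ϖ^{i+j}`. -/
theorem indexTwo_of_order (hP : RootDecompOrderCut.ProperCone) (hR : ReducedPeriodRing) (g : FormalPeriodRing)
    (i j : ℕ) (hrel : piClass ^ j * (g * g - piClass ^ (2 * i)) = 0) (hv : evalP g = Real.pi ^ i) :
    piClass ^ j * g = piClass ^ (i + j) := by
  have huw : (piClass ^ j * g) * (piClass ^ j * g) = piClass ^ (i + j) * piClass ^ (i + j) := by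
    linear_combination (piClass ^ j) * hrel
  have hvw : evalP (piClass ^ j * g) = evalP (piClass ^ (i + j)) := by
    rw [map_mul, evalP_piClass_pow, evalP_piClass_pow, hv]; ring
  exact quadRigid_of_order hP hR _ _ huw hvw (evalP_piClass_pow_ne_zero _)

end Summit.KontsevichZagierPeriods.RootDecompOrderCut

/-! ## Registered line on crux 32161 `DefectNegligible` (writer decomp-kz-writer-1 g3, skeleton sha e848aa1ae17f624a…,
namespace `…Cruxes.DefectNegligible.Birth`, stubs `stub_flat` (= item 27508 `PiFlatDefect` verbatim, OPEN) and `stub_posCert`):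
the stub `stub_posCert` BY NAME AND SIGNATURE — it is `RootDecompPureDefect.posCertificate` (landed part
`…Theorems.RootDecompPureDefectProperConeP1`, lens-5 g9 §12a: value-positivity certified INSIDE the calculus from the tree's
Viu-Sos compact-volume API + Archimedes). -/

namespace Summit.KontsevichZagierPeriods.KontsevichZagierPeriods.Cruxes.DefectNegligible.Birth

set_option linter.dupNamespace false in
/-- **`stub_posCert` of the registered line on 32161, PROVED** (`(M+1)·g = 1 + c` with `c` the class of ONE representation with
non-negative integrand and positive value, for every `g` of positive value) — by `RootDecompPureDefect.posCertificate`. -/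
theorem stub_posCert : ∀ g : Literature.NumberTheory.Transcendental.KZ.FormalPeriodRing, 0 < Literature.NumberTheory.Transcendental.KZ.evalP g → ∃ (M : ℕ) (c : Literature.NumberTheory.Transcendental.KZ.FormalPeriodRing), (∃ (N : ℕ) (r : Literature.NumberTheory.Transcendental.KZ.IntegralRep N), (∀ z ∈ r.domain, 0 ≤ r.integrand z) ∧ 0 < r.value ∧ Literature.NumberTheory.Transcendental.KZ.toFormalPeriod (Literature.NumberTheory.Transcendental.KZ.of r) = c) ∧ ((M : Literature.NumberTheory.Transcendental.KZ.FormalPeriodRing) + 1) * g = 1 + c :=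
  fun g hg => Summit.KontsevichZagierPeriods.RootDecompPureDefect.posCertificate g hg

end Summit.KontsevichZagierPeriods.KontsevichZagierPeriods.Cruxes.DefectNegligible.Birth
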